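import Summits.QuantumFields.BalabanUV.T4Continuum.Support.G183FreePartProducts

/-!
# G183FreePartPieces — part 4/5 of the proof of `G183KernelRates.FreePartRate`: the Γ-type time integral
# `∫₀^∞ t^{−(d+3)/2}e^{−ρ²/64t}dt = 8^{d+1}Γ((d+1)/2)ρ^{−(d+1)}` and the three time-pieces `piece_small` (`t ≤ 1/(2l²)`),
# `piece_mid` (`1/(2m²) < t ≤ 1/(2n²)`, level `m` alone) and `piece_large` (`t > 1/(2n²)`, the telescoped difference), each
# `≤ K · n^{−2} ρ^{−(d+1)} e^{−cρ}`

Cell `pub-balaban`, T4-DAG §5 node U1a, spine estimate NE2, prover P2, lineage t4-ne2-p2 gen 8, row T4-U1a.E-NE2-PROVE-P2h*.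
HONEST FRAMING: rung (B)+1 bookkeeping for the LINEAR theory at `U = 1` on the infinite fine lattices `(1/n)ℤ^{d+1}`; NOT the
torus, NOT `U ≠ 1`, NOT infinite-volume physics, NOT a mass gap, NOT Clay.  Inputs: Mathlib and kernel-proved tree theorems BY
NAME (`Literature.Probability.LatticeModels.*` after Lawler–Limic 2010 [LawlerLimic2010]; `G183KernelRates` gen 7); nothing
printed in the audited papers is a hypothesis; no `def … : Prop` is assumed; no `sorry`.  All namespace
`Summit.QuantumFields.BalabanUV.T4Continuum.G183FreePartRate` (one proof split over five ≤ 400-line files: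
`G183FreePartOneDim` §1–§2 → `G183FreePartSubordination` §3–§4 → `G183FreePartProducts` §5–§6 → `G183FreePartPieces` §7 →
`G183FreePartRate` §8 = the theorem and the full header: statement, proof outline, reading, sources).
-/

noncomputable section

open MeasureTheory Set Filter Real
open scoped Real Topology BigOperators

namespace Summit.QuantumFields.BalabanUV.T4Continuum.G183FreePartRate

open Literature.Probability.LatticeModels

/-! ## §7 The four time-pieces -/

section Pieces

variable {d : ℕ}

/-- `w_N(t) ≤ 2^N` for `t ≥ 0`. [folklore] -/
theorem wN_le_two_pow (N : ℕ) {t : ℝ} (ht : 0 ≤ t) : wN N t ≤ 2 ^ N :=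
  (wN_le N ht).trans (mul_le_of_le_one_right (by positivity)
    (Real.exp_le_one_iff.2 (by nlinarith)))

/-- `L^D e^{−ρL/c} ≤ (2c)^D D! ρ^{−D} e^{−ρL/(2c)}`: lattice powers of the level are paid for by half of an
exponential in the LATTICE distance `ρL`. [folklore] -/
theorem pow_mul_exp_le_inv_pow (D : ℕ) {c ρ L : ℝ} (hc : 0 < c) (hρ : 0 < ρ) (hL : 0 ≤ L) :
    L ^ D * Real.exp (-(ρ * L / c)) ≤ (2 * c) ^ D * D.factorial * (ρ ^ D)⁻¹ * Real.exp (-(ρ * L / (2 * c))) := by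
  have h := pow_mul_exp_neg_div_le D (by positivity : 0 < 2 * c) (by positivity : 0 ≤ ρ * L)
  have e1 : Real.exp (-(ρ * L / c)) = Real.exp (-(ρ * L / (2 * c))) * Real.exp (-(ρ * L / (2 * c))) := by
    rw [← Real.exp_add]; congr 1; field_simp; ring
  have e2 : L ^ D = (ρ ^ D)⁻¹ * (ρ * L) ^ D := by
    rw [mul_pow, ← mul_assoc, inv_mul_cancel₀ (by positivity), one_mul]
  rw [e1, e2]
  calc (ρ ^ D)⁻¹ * (ρ * L) ^ D * (Real.exp (-(ρ * L / (2 * c))) * Real.exp (-(ρ * L / (2 * c))))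
      = (ρ ^ D)⁻¹ * ((ρ * L) ^ D * Real.exp (-(ρ * L / (2 * c)))) * Real.exp (-(ρ * L / (2 * c))) := by ring
    _ ≤ (ρ ^ D)⁻¹ * ((2 * c) ^ D * D.factorial) * Real.exp (-(ρ * L / (2 * c))) := by gcongr
    _ = _ := by ring

/-- `(1/y)^{−z} = y^z` (`y ≥ 0`). [folklore] -/
theorem one_div_rpow_neg {y : ℝ} (hy : 0 ≤ y) (z : ℝ) : (1 / y) ^ (-z) = y ^ z := by
  rw [Real.rpow_neg (by positivity), one_div, Real.inv_rpow hy, inv_inv]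

/-- the Gaussian time integral `∫₀^∞ t^{−(d+3)/2} e^{−ρ²/(64t)} dt = 8^{d+1} Γ((d+1)/2) ρ^{−(d+1)}`. [folklore] -/
theorem gaussTimeIntegral (d : ℕ) {ρ : ℝ} (hρ : 0 < ρ) :
    IntegrableOn (fun t : ℝ => t ^ (-(((d : ℝ) + 3) / 2)) * Real.exp (-(ρ ^ 2 / (64 * t)))) (Ioi 0) ∧
    ∫ t in Ioi (0 : ℝ), t ^ (-(((d : ℝ) + 3) / 2)) * Real.exp (-(ρ ^ 2 / (64 * t))) =
      8 ^ (d + 1) * Real.Gamma (((d : ℝ) + 1) / 2) * (ρ ^ (d + 1))⁻¹ := by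
  -- `(y²)^{k/2} = y^k` (in the tree as `Literature.Geometry.Riemannian.sq_rpow_natCast_div_two`,
  -- restated locally to avoid a heavy import)
  have sq_rpow_half : ∀ {y : ℝ}, 0 ≤ y → ∀ k : ℕ, (y ^ 2) ^ ((k : ℝ) / 2) = y ^ k :=
    fun {y} hy k => by
      rw [show (y ^ 2 : ℝ) = y ^ (2 : ℝ) by norm_cast, ← Real.rpow_mul hy,
        show (2 : ℝ) * ((k : ℝ) / 2) = (k : ℕ) by ring, Real.rpow_natCast]
  have hβ : (1 : ℝ) < ((d : ℝ) + 3) / 2 := by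
    have := Nat.cast_nonneg (α := ℝ) d; linarith
  have h := integral_Ioi_rpow_neg_mul_exp_neg_div (α := ρ ^ 2 / 64) (β := ((d : ℝ) + 3) / 2) (by positivity) hβ
  simp_rw [div_div] at h
  have e1 : (1 / (ρ ^ 2 / 64)) ^ (((d : ℝ) + 3) / 2 - 1) * Real.Gamma (((d : ℝ) + 3) / 2 - 1) =
      8 ^ (d + 1) * Real.Gamma (((d : ℝ) + 1) / 2) * (ρ ^ (d + 1))⁻¹ := by
    rw [show ((d : ℝ) + 3) / 2 - 1 = ((d + 1 : ℕ) : ℝ) / 2 by push_cast; ring,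
      show (1 / (ρ ^ 2 / 64) : ℝ) = (8 / ρ) ^ 2 by field_simp; norm_num,
      sq_rpow_half (by positivity) (d + 1), div_pow, div_eq_mul_inv]
    push_cast; ring
  rw [e1] at h
  refine ⟨?_, h⟩
  by_contra hni
  rw [integral_undef hni] at h
  have : 0 < 8 ^ (d + 1) * Real.Gamma (((d : ℝ) + 1) / 2) * (ρ ^ (d + 1))⁻¹ := by
    have hG : 0 < Real.Gamma (((d : ℝ) + 1) / 2) := Real.Gamma_pos_of_pos (by positivity)
    positivity
  linarith

/-- PIECE C (small times at level `l`): `‖∫_{(0,1/(2l²)]} w_N P_l(·,y)‖ ≤ 2^N e^{7(d+1)/8} 2^{d+1}(d+1)! n^{−2} ρ^{−(d+1)}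
e^{−ρ/2}` whenever `n ≤ l` and `ρ·l ≤ |y_{i₀}|`. [folklore] -/
theorem piece_small (N : ℕ) {n l : ℕ} (hn : 1 ≤ n) (hnl : n ≤ l) (y : Fin (d + 1) → ℤ) (i₀ : Fin (d + 1))
    {ρ : ℝ} (hρ : 0 < ρ) (hy : ρ * l ≤ |((y i₀ : ℤ) : ℝ)|) :
    ‖∫ t in Ioc (0 : ℝ) (1 / (2 * (l : ℝ) ^ 2)), wN N t * levelProd (d := d) l t y‖ ≤
      2 ^ N * Real.exp (7 / 8) ^ (d + 1) * (2 ^ (d + 1) * (d + 1).factorial) *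
        ((n : ℝ) ^ 2)⁻¹ * (ρ ^ (d + 1))⁻¹ * Real.exp (-(ρ / 2)) := by
  have hl : 1 ≤ l := hn.trans hnl
  have hl0 : (0 : ℝ) < l := by exact_mod_cast hl
  have hl1 : (1 : ℝ) ≤ l := by exact_mod_cast hl
  have hn0 : (0 : ℝ) < n := by exact_mod_cast hn
  have hnl' : (n : ℝ) ≤ l := by exact_mod_cast hnl
  set L : ℝ := 1 / (2 * (l : ℝ) ^ 2) with hL
  have hL0 : 0 < L := by positivity
  have hb : ∀ t ∈ Ioc (0 : ℝ) L, ‖wN N t * levelProd (d := d) l t y‖ ≤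
      2 ^ N * (((l : ℝ) * Real.exp (7 / 8)) ^ (d + 1) * Real.exp (-(ρ * l / 1))) := by
    intro t ht
    have ht2 : 2 * (l : ℝ) ^ 2 * t ≤ 1 := by
      have h2 := ht.2
      rw [hL, le_div_iff₀ (by positivity)] at h2
      linarith
    rw [norm_mul, Real.norm_eq_abs, Real.norm_eq_abs, abs_of_nonneg (wN_nonneg N ht.1.le)]
    refine mul_le_mul (wN_le_two_pow N ht.1.le) ((abs_levelProd_le_small hl ht.1.le ht2 y i₀).trans ?_)
      (abs_nonneg _) (by positivity)
    refine mul_le_mul_of_nonneg_left (Real.exp_le_exp.2 ?_) (by positivity)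
    rw [Int.cast_abs, div_one]; linarith
  have h := norm_setIntegral_le_of_norm_le_const (show volume (Ioc (0 : ℝ) L) < ⊤ from measure_Ioc_lt_top) hb
  rw [Real.volume_real_Ioc_of_le hL0.le, sub_zero] at h
  have hconv := pow_mul_exp_le_inv_pow (d + 1) one_pos hρ hl0.le
  have hLn : L ≤ ((n : ℝ) ^ 2)⁻¹ := by
    rw [hL, one_div]
    exact inv_anti₀ (by positivity) (by nlinarith [mul_le_mul hnl' hnl' hn0.le hl0.le])
  have hexp : Real.exp (-(ρ * l / (2 * 1))) ≤ Real.exp (-(ρ / 2)) :=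
    Real.exp_le_exp.2 (by rw [mul_one]; exact neg_le_neg (by rw [le_div_iff₀ two_pos] at *; nlinarith))
  calc ‖∫ t in Ioc (0 : ℝ) L, wN N t * levelProd (d := d) l t y‖
      ≤ 2 ^ N * (((l : ℝ) * Real.exp (7 / 8)) ^ (d + 1) * Real.exp (-(ρ * l / 1))) * L := h
    _ = 2 ^ N * Real.exp (7 / 8) ^ (d + 1) * ((l : ℝ) ^ (d + 1) * Real.exp (-(ρ * l / 1))) * L := by
        rw [mul_pow]; ring
    _ ≤ 2 ^ N * Real.exp (7 / 8) ^ (d + 1) *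
          ((2 * 1) ^ (d + 1) * (d + 1).factorial * (ρ ^ (d + 1))⁻¹ * Real.exp (-(ρ * l / (2 * 1)))) *
          ((n : ℝ) ^ 2)⁻¹ :=
        mul_le_mul (mul_le_mul_of_nonneg_left hconv (by positivity)) hLn hL0.le (by positivity)
    _ ≤ 2 ^ N * Real.exp (7 / 8) ^ (d + 1) *
          ((2 * 1) ^ (d + 1) * (d + 1).factorial * (ρ ^ (d + 1))⁻¹ * Real.exp (-(ρ / 2))) *
          ((n : ℝ) ^ 2)⁻¹ := by gcongr
    _ = _ := by ring

/-- PIECE E (intermediate times `1/(2m²) < t ≤ 1/(2n²)`, level `m` only): bounded by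
`2^N 2^d 16^{d+1}(d+1)!(e^{1/16}+1) n^{−2} ρ^{−(d+1)} e^{−ρ/16}`. [folklore] -/
theorem piece_mid (N : ℕ) {n m : ℕ} (hn : 1 ≤ n) (hnm : n ≤ m) (x' : Fin (d + 1) → ℤ) (i₀ : Fin (d + 1))
    {ρ : ℝ} (hρ : 0 < ρ) (hρn : 1 ≤ ρ * n) (hsq : (((x' i₀ : ℤ) : ℝ) / m) ^ 2 = ρ ^ 2)
    (habs : |((x' i₀ : ℤ) : ℝ)| = ρ * m) :
    ‖∫ t in Ioc (1 / (2 * (m : ℝ) ^ 2)) (1 / (2 * (n : ℝ) ^ 2)), wN N t * levelProd (d := d) m t x'‖ ≤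
      2 ^ N * 2 ^ d * (16 ^ (d + 1) * (d + 1).factorial * (Real.exp (1 / 16) + 1)) *
        ((n : ℝ) ^ 2)⁻¹ * (ρ ^ (d + 1))⁻¹ * Real.exp (-(ρ / 16)) := by
  -- `(y²)^{k/2} = y^k` (in the tree as `Literature.Geometry.Riemannian.sq_rpow_natCast_div_two`,
  -- restated locally to avoid a heavy import)
  have sq_rpow_half : ∀ {y : ℝ}, 0 ≤ y → ∀ k : ℕ, (y ^ 2) ^ ((k : ℝ) / 2) = y ^ k :=
    fun {y} hy k => by
      rw [show (y ^ 2 : ℝ) = y ^ (2 : ℝ) by norm_cast, ← Real.rpow_mul hy,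
        show (2 : ℝ) * ((k : ℝ) / 2) = (k : ℕ) by ring, Real.rpow_natCast]
  have hm : 1 ≤ m := hn.trans hnm
  have hm0 : (0 : ℝ) < m := by exact_mod_cast hm
  have hm1 : (1 : ℝ) ≤ m := by exact_mod_cast hm
  have hn0 : (0 : ℝ) < n := by exact_mod_cast hn
  have hn1 : (1 : ℝ) ≤ n := by exact_mod_cast hn
  have hnm' : (n : ℝ) ≤ m := by exact_mod_cast hnm
  set a : ℝ := 1 / (2 * (n : ℝ) ^ 2) with ha
  set b : ℝ := 1 / (2 * (m : ℝ) ^ 2) with hb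
  have ha0 : 0 < a := by positivity
  have hb0 : 0 < b := by positivity
  have hba : b ≤ a := by
    rw [ha, hb]; exact one_div_le_one_div_of_le (by positivity) (by nlinarith [mul_le_mul hnm' hnm' hn0.le hm0.le])
  -- `2t ≤ ρ` on the piece
  have hρ1n : 1 / (n : ℝ) ≤ ρ := by rw [div_le_iff₀ hn0]; linarith
  set KG : ℝ := 16 ^ (d + 1) * (d + 1).factorial * Real.exp (1 / 16) with hKG
  set KP : ℝ := (2 * 8) ^ (d + 1) * (d + 1).factorial with hKP
  have hbd : ∀ t ∈ Ioc b a, ‖wN N t * levelProd (d := d) m t x'‖ ≤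
      2 ^ N * (2 ^ d * ((KG + KP) * (ρ ^ (d + 1))⁻¹ * Real.exp (-(ρ / 16)))) := by
    intro t ht
    have ht0 : 0 < t := hb0.trans ht.1
    have htm : 1 ≤ 2 * (m : ℝ) ^ 2 * t := by
      have h1 := le_of_lt ht.1
      rw [hb, div_le_iff₀ (by positivity)] at h1
      linarith
    have h2t : 2 * t ≤ ρ := by
      have h1 := ht.2
      rw [ha, le_div_iff₀ (by positivity)] at h1
      have : 2 * t ≤ 1 / (n : ℝ) := by
        rw [le_div_iff₀ hn0]; nlinarith
      linarith
    rw [norm_mul, Real.norm_eq_abs, Real.norm_eq_abs, abs_of_nonneg (wN_nonneg N ht0.le)]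
    refine mul_le_mul (wN_le_two_pow N ht0.le) ((abs_levelProd_le_large hm htm x' i₀).trans ?_)
      (abs_nonneg _) (by positivity)
    rw [hsq, habs, mul_assoc]
    refine mul_le_mul_of_nonneg_left ?_ (by positivity)
    rw [mul_add, show (KG + KP) * (ρ ^ (d + 1))⁻¹ * Real.exp (-(ρ / 16)) =
      KG * (ρ ^ (d + 1))⁻¹ * Real.exp (-(ρ / 16)) + KP * (ρ ^ (d + 1))⁻¹ * Real.exp (-(ρ / 16)) by ring]
    refine add_le_add ?_ ?_
    · -- Gaussian part
      have hsplit : Real.exp (-(ρ ^ 2 / (16 * t))) =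
          Real.exp (-(ρ ^ 2 / (32 * t))) * Real.exp (-(ρ ^ 2 / (32 * t))) := by
        rw [← Real.exp_add]; congr 1; field_simp; ring
      have hG := gaussFactor_le (d + 1) ht0 hρ
      have htail : Real.exp (-(ρ ^ 2 / (32 * t))) ≤ Real.exp (-(ρ / 16)) := by
        refine Real.exp_le_exp.2 (neg_le_neg ?_)
        rw [div_le_div_iff₀ (by norm_num) (by positivity)]
        nlinarith [mul_le_mul_of_nonneg_left h2t hρ.le]
      rw [hsplit, ← mul_assoc, show (((d : ℝ) + 1) / 2) = ((d + 1 : ℕ) : ℝ) / 2 by push_cast; ring]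
      exact mul_le_mul hG htail (by positivity) (by positivity)
    · -- Poisson part
      have hpow : (2 * t) ^ (-(((d : ℝ) + 1) / 2)) ≤ (m : ℝ) ^ (d + 1) := by
        have h1 : 1 / (m : ℝ) ^ 2 ≤ 2 * t := by rw [div_le_iff₀ (by positivity)]; linarith
        calc (2 * t) ^ (-(((d : ℝ) + 1) / 2)) ≤ (1 / (m : ℝ) ^ 2) ^ (-(((d : ℝ) + 1) / 2)) :=
              Real.rpow_le_rpow_of_nonpos (by positivity) h1 (by
                have := Nat.cast_nonneg (α := ℝ) d; apply neg_nonpos.2; positivity)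
          _ = (m : ℝ) ^ (d + 1) := by
              rw [show (((d : ℝ) + 1) / 2) = ((d + 1 : ℕ) : ℝ) / 2 by push_cast; ring,
                one_div_rpow_neg (by positivity), sq_rpow_half hm0.le]
      have hconv := pow_mul_exp_le_inv_pow (d + 1) (by norm_num : (0:ℝ) < 8) hρ hm0.le
      have hexp : Real.exp (-(ρ * m / (2 * 8))) ≤ Real.exp (-(ρ / 16)) :=
        Real.exp_le_exp.2 (neg_le_neg (by rw [div_le_div_iff₀ (by norm_num) (by norm_num)]; nlinarith))
      calc (2 * t) ^ (-(((d : ℝ) + 1) / 2)) * Real.exp (-(ρ * m / 8))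
          ≤ (m : ℝ) ^ (d + 1) * Real.exp (-(ρ * m / 8)) := by gcongr
        _ ≤ (2 * 8) ^ (d + 1) * (d + 1).factorial * (ρ ^ (d + 1))⁻¹ * Real.exp (-(ρ * m / (2 * 8))) := hconv
        _ ≤ (2 * 8) ^ (d + 1) * (d + 1).factorial * (ρ ^ (d + 1))⁻¹ * Real.exp (-(ρ / 16)) := by gcongr
        _ = KP * (ρ ^ (d + 1))⁻¹ * Real.exp (-(ρ / 16)) := by rw [hKP]
  have h := norm_setIntegral_le_of_norm_le_const (show volume (Ioc b a) < ⊤ from measure_Ioc_lt_top) hbd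
  rw [Real.volume_real_Ioc_of_le hba] at h
  have hlen : a - b ≤ ((n : ℝ) ^ 2)⁻¹ := by
    have : a ≤ ((n : ℝ) ^ 2)⁻¹ := by
      rw [ha, one_div]; exact inv_anti₀ (by positivity) (by nlinarith)
    linarith
  have hK : KG + KP = 16 ^ (d + 1) * (d + 1).factorial * (Real.exp (1 / 16) + 1) := by
    rw [hKG, hKP]; norm_num; ring
  calc ‖∫ t in Ioc b a, wN N t * levelProd (d := d) m t x'‖
      ≤ 2 ^ N * (2 ^ d * ((KG + KP) * (ρ ^ (d + 1))⁻¹ * Real.exp (-(ρ / 16)))) * (a - b) := h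
    _ ≤ 2 ^ N * (2 ^ d * ((KG + KP) * (ρ ^ (d + 1))⁻¹ * Real.exp (-(ρ / 16)))) * ((n : ℝ) ^ 2)⁻¹ :=
        mul_le_mul_of_nonneg_left hlen (by positivity)
    _ = _ := by rw [hK]; ring


/-- PIECE A–B (large times `t > 1/(2n²)`, the telescoped difference): bounded by
`2^N K₁ (8^{d+1}Γ((d+1)/2) + (2/(d+1))·64^{d+1}(d+1)!) n^{−2} ρ^{−(d+1)} e^{−ρ/64}`, `K₁ = (d+1)·2C₂·2^d`. [folklore] -/
theorem piece_large (N : ℕ) {n m : ℕ} (hn : 1 ≤ n) (hnm : n ≤ m) (x x' : Fin (d + 1) → ℤ)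
    (hx' : ∀ i, x' i * n = x i * m) (i₀ : Fin (d + 1)) {ρ u : ℝ} (hρ : 0 < ρ) (hu1 : 1 ≤ u)
    (hun : u = ρ * n) (hxi : |((x i₀ : ℤ) : ℝ)| = u) :
    ‖∫ t in Ioi (1 / (2 * (n : ℝ) ^ 2)), wN N t * (levelProd (d := d) m t x' - levelProd (d := d) n t x)‖ ≤
      2 ^ N * (((d : ℝ) + 1) * (2 * C2) * 2 ^ d) *
        (8 ^ (d + 1) * Real.Gamma (((d : ℝ) + 1) / 2) + 2 / ((d : ℝ) + 1) * (64 ^ (d + 1) * (d + 1).factorial)) *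
        ((n : ℝ) ^ 2)⁻¹ * (ρ ^ (d + 1))⁻¹ * Real.exp (-(ρ / 64)) := by
  -- `(y²)^{k/2} = y^k` (in the tree as `Literature.Geometry.Riemannian.sq_rpow_natCast_div_two`,
  -- restated locally to avoid a heavy import)
  have sq_rpow_half : ∀ {y : ℝ}, 0 ≤ y → ∀ k : ℕ, (y ^ 2) ^ ((k : ℝ) / 2) = y ^ k :=
    fun {y} hy k => by
      rw [show (y ^ 2 : ℝ) = y ^ (2 : ℝ) by norm_cast, ← Real.rpow_mul hy,
        show (2 : ℝ) * ((k : ℝ) / 2) = (k : ℕ) by ring, Real.rpow_natCast]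
  have hn0 : (0 : ℝ) < n := by exact_mod_cast hn
  have hn1 : (1 : ℝ) ≤ n := by exact_mod_cast hn
  have hd0 := Nat.cast_nonneg (α := ℝ) d
  obtain ⟨hGi, hGv⟩ := gaussTimeIntegral d hρ
  set a : ℝ := 1 / (2 * (n : ℝ) ^ 2) with ha
  have ha0 : 0 < a := by positivity
  set K₁ : ℝ := ((d : ℝ) + 1) * (2 * C2) * 2 ^ d with hK₁
  have hK₁0 : 0 ≤ K₁ := by have := C2_pos; positivity
  have hβ1 : (1 : ℝ) < ((d : ℝ) + 3) / 2 := by linarith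
  have hsqρ : ((((x i₀ : ℤ) : ℝ)) / n) ^ 2 = ρ ^ 2 := by
    rw [div_pow, ← sq_abs, hxi, hun]; field_simp
  set c₀ : ℝ := 2 ^ N * K₁ * ((n : ℝ) ^ 2)⁻¹ with hc₀
  have hc₀0 : 0 ≤ c₀ := by positivity
  -- integrable majorant on `(a, ∞)`
  have h1 : IntegrableOn (fun t : ℝ => t ^ (-(((d : ℝ) + 3) / 2)) * Real.exp (-(ρ ^ 2 / (64 * t)))) (Ioi a) :=
    hGi.mono_set (Set.Ioi_subset_Ioi ha0.le)
  have h2 : IntegrableOn (fun t : ℝ => t ^ (-(((d : ℝ) + 3) / 2))) (Ioi a) :=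
    integrableOn_Ioi_rpow_of_lt (by linarith) ha0
  have hgi : IntegrableOn (fun t : ℝ => c₀ * (Real.exp (-(ρ / 8)) * (t ^ (-(((d : ℝ) + 3) / 2)) *
      Real.exp (-(ρ ^ 2 / (64 * t)))) + Real.exp (-(u / 16)) * t ^ (-(((d : ℝ) + 3) / 2)))) (Ioi a) :=
    ((h1.const_mul _).add (h2.const_mul _)).const_mul _
  have hbound : ∀ᵐ t ∂(volume.restrict (Ioi a)),
      ‖wN N t * (levelProd (d := d) m t x' - levelProd (d := d) n t x)‖ ≤
        c₀ * (Real.exp (-(ρ / 8)) * (t ^ (-(((d : ℝ) + 3) / 2)) * Real.exp (-(ρ ^ 2 / (64 * t)))) +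
          Real.exp (-(u / 16)) * t ^ (-(((d : ℝ) + 3) / 2))) := by
    filter_upwards [ae_restrict_mem measurableSet_Ioi] with t ht
    have hat : a < t := ht
    have ht0 : 0 < t := ha0.trans hat
    have ht1 : 1 ≤ 2 * (n : ℝ) ^ 2 * t := by
      have h1 := le_of_lt hat
      rw [ha, div_le_iff₀ (by positivity)] at h1
      linarith
    have hP := abs_levelProd_sub_le hn hnm ht1 x x' hx' i₀
    rw [hsqρ, hxi] at hP
    rw [norm_mul, Real.norm_eq_abs, Real.norm_eq_abs, abs_of_nonneg (wN_nonneg N ht0.le)]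
    have h2t : (2 * t) ^ (-(((d : ℝ) + 3) / 2)) ≤ t ^ (-(((d : ℝ) + 3) / 2)) :=
      Real.rpow_le_rpow_of_nonpos ht0 (by linarith) (by linarith)
    have hE1 : Real.exp (-(1 / 2) * t) ≤ 1 := Real.exp_le_one_iff.2 (by nlinarith)
    have hG := exp_half_mul_gauss_le ht0 ρ
    have hpos : 0 ≤ K₁ * ((n : ℝ) ^ 2)⁻¹ * (2 * t) ^ (-(((d : ℝ) + 3) / 2)) *
        (Real.exp (-(ρ ^ 2 / (32 * t))) + Real.exp (-(u / 16))) := by positivity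
    calc wN N t * |levelProd (d := d) m t x' - levelProd (d := d) n t x|
        ≤ (2 ^ N * Real.exp (-(1 / 2) * t)) * (K₁ * ((n : ℝ) ^ 2)⁻¹ * (2 * t) ^ (-(((d : ℝ) + 3) / 2)) *
            (Real.exp (-(ρ ^ 2 / (32 * t))) + Real.exp (-(u / 16)))) :=
          mul_le_mul (wN_le N ht0.le) (hP.trans_eq (by rw [hK₁])) (abs_nonneg _) (by positivity)
      _ = c₀ * (2 * t) ^ (-(((d : ℝ) + 3) / 2)) * ((Real.exp (-(1 / 2) * t) * Real.exp (-(ρ ^ 2 / (32 * t)))) +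
            Real.exp (-(1 / 2) * t) * Real.exp (-(u / 16))) := by rw [hc₀]; ring
      _ ≤ c₀ * t ^ (-(((d : ℝ) + 3) / 2)) * ((Real.exp (-(ρ / 8)) * Real.exp (-(ρ ^ 2 / (64 * t)))) +
            1 * Real.exp (-(u / 16))) := by gcongr
      _ = _ := by ring
  -- the two elementary time integrals
  have hI1 : ∫ t in Ioi a, t ^ (-(((d : ℝ) + 3) / 2)) * Real.exp (-(ρ ^ 2 / (64 * t))) ≤
      8 ^ (d + 1) * Real.Gamma (((d : ℝ) + 1) / 2) * (ρ ^ (d + 1))⁻¹ := by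
    rw [← hGv]
    refine setIntegral_mono_set hGi ?_ (Set.Ioi_subset_Ioi ha0.le).eventuallyLE
    filter_upwards [ae_restrict_mem measurableSet_Ioi] with t ht
    have : 0 < t := ht
    simp only [Pi.zero_apply]
    positivity
  have hI1pos : 0 ≤ ∫ t in Ioi a, t ^ (-(((d : ℝ) + 3) / 2)) * Real.exp (-(ρ ^ 2 / (64 * t))) :=
    setIntegral_nonneg measurableSet_Ioi fun t ht => by have := ha0.trans ht; positivity
  have hI2 : ∫ t in Ioi a, t ^ (-(((d : ℝ) + 3) / 2)) = 2 / ((d : ℝ) + 1) * a ^ (-(((d : ℝ) + 1) / 2)) := by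
    rw [integral_Ioi_rpow_of_lt (by linarith) ha0,
      show -(((d : ℝ) + 3) / 2) + 1 = -(((d : ℝ) + 1) / 2) by ring, neg_div_neg_eq]
    have hD : (0 : ℝ) < (d : ℝ) + 1 := by linarith
    field_simp
  have ha_pow : a ^ (-(((d : ℝ) + 1) / 2)) ≤ 2 ^ (d + 1) * (n : ℝ) ^ (d + 1) := by
    rw [ha, show (((d : ℝ) + 1) / 2) = ((d + 1 : ℕ) : ℝ) / 2 by push_cast; ring,
      one_div_rpow_neg (by positivity)]
    calc (2 * (n : ℝ) ^ 2) ^ (((d + 1 : ℕ) : ℝ) / 2) ≤ ((2 * (n : ℝ)) ^ 2) ^ (((d + 1 : ℕ) : ℝ) / 2) :=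
          Real.rpow_le_rpow (by positivity) (by nlinarith) (by positivity)
      _ = 2 ^ (d + 1) * (n : ℝ) ^ (d + 1) := by rw [sq_rpow_half (by positivity), mul_pow]
  have hT1 : Real.exp (-(ρ / 8)) * ∫ t in Ioi a, t ^ (-(((d : ℝ) + 3) / 2)) * Real.exp (-(ρ ^ 2 / (64 * t))) ≤
      Real.exp (-(ρ / 64)) * (8 ^ (d + 1) * Real.Gamma (((d : ℝ) + 1) / 2) * (ρ ^ (d + 1))⁻¹) :=
    mul_le_mul (Real.exp_le_exp.2 (by linarith [hρ.le])) hI1 hI1pos (by positivity)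
  have hT2 : Real.exp (-(u / 16)) * ∫ t in Ioi a, t ^ (-(((d : ℝ) + 3) / 2)) ≤
      2 / ((d : ℝ) + 1) * (64 ^ (d + 1) * (d + 1).factorial) * (ρ ^ (d + 1))⁻¹ * Real.exp (-(ρ / 64)) := by
    rw [hI2, hun]
    have hconv := pow_mul_exp_le_inv_pow (d + 1) (by norm_num : (0:ℝ) < 16) hρ hn0.le
    have hexp : Real.exp (-(ρ * n / (2 * 16))) ≤ Real.exp (-(ρ / 64)) :=
      Real.exp_le_exp.2 (neg_le_neg (by rw [div_le_div_iff₀ (by norm_num) (by norm_num)]; nlinarith))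
    have hD : (0 : ℝ) ≤ 2 / ((d : ℝ) + 1) := by positivity
    calc Real.exp (-(ρ * n / 16)) * (2 / ((d : ℝ) + 1) * a ^ (-(((d : ℝ) + 1) / 2)))
        ≤ Real.exp (-(ρ * n / 16)) * (2 / ((d : ℝ) + 1) * (2 ^ (d + 1) * (n : ℝ) ^ (d + 1))) := by gcongr
      _ = 2 / ((d : ℝ) + 1) * 2 ^ (d + 1) * ((n : ℝ) ^ (d + 1) * Real.exp (-(ρ * n / 16))) := by ring
      _ ≤ 2 / ((d : ℝ) + 1) * 2 ^ (d + 1) *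
            ((2 * 16) ^ (d + 1) * (d + 1).factorial * (ρ ^ (d + 1))⁻¹ * Real.exp (-(ρ * n / (2 * 16)))) :=
          mul_le_mul_of_nonneg_left hconv (by positivity)
      _ ≤ 2 / ((d : ℝ) + 1) * 2 ^ (d + 1) *
            ((2 * 16) ^ (d + 1) * (d + 1).factorial * (ρ ^ (d + 1))⁻¹ * Real.exp (-(ρ / 64))) := by gcongr
      _ = _ := by
          rw [show (64 : ℝ) ^ (d + 1) = 2 ^ (d + 1) * (2 * 16) ^ (d + 1) by rw [← mul_pow]; norm_num]
          ring
  -- conclusion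
  calc ‖∫ t in Ioi a, wN N t * (levelProd (d := d) m t x' - levelProd (d := d) n t x)‖
      ≤ ∫ t in Ioi a, c₀ * (Real.exp (-(ρ / 8)) * (t ^ (-(((d : ℝ) + 3) / 2)) * Real.exp (-(ρ ^ 2 / (64 * t)))) +
          Real.exp (-(u / 16)) * t ^ (-(((d : ℝ) + 3) / 2))) := norm_integral_le_of_norm_le hgi hbound
    _ = c₀ * (Real.exp (-(ρ / 8)) * (∫ t in Ioi a, t ^ (-(((d : ℝ) + 3) / 2)) * Real.exp (-(ρ ^ 2 / (64 * t)))) +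
          Real.exp (-(u / 16)) * ∫ t in Ioi a, t ^ (-(((d : ℝ) + 3) / 2))) := by
        rw [integral_const_mul, integral_add (h1.const_mul _) (h2.const_mul _), integral_const_mul,
          integral_const_mul]
    _ ≤ c₀ * (Real.exp (-(ρ / 64)) * (8 ^ (d + 1) * Real.Gamma (((d : ℝ) + 1) / 2) * (ρ ^ (d + 1))⁻¹) +
          2 / ((d : ℝ) + 1) * (64 ^ (d + 1) * (d + 1).factorial) * (ρ ^ (d + 1))⁻¹ * Real.exp (-(ρ / 64))) :=
        mul_le_mul_of_nonneg_left (add_le_add hT1 hT2) hc₀0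
    _ = _ := by rw [hc₀]; ring

end Pieces

end Summit.QuantumFields.BalabanUV.T4Continuum.G183FreePartRate
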